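import Summits.ResolutionOfSingularities.ResolutionOfSingularities.Theorems.RadicialJungCleanModelsT2BlowupStalkChart
import Summits.ResolutionOfSingularities.ResolutionOfSingularities.Theorems.RadicialJungCleanModelsT2GiraudInvariantsTransport
import Summits.ResolutionOfSingularities.ResolutionOfSingularities.Theorems.RadicialJungCleanModelsGiraudChartPrimes
import Literature.AlgebraicGeometry.Resolution.StalkIdealLemmas
import HarnessLib

/-!
# Route `RadicialJung`, crux `CleanModels` (stmt-15917): the critical primes of `f` at a stalk,
# and at the points of the blow-up of a closed point (T2 brick B5-d, item (d2))

Support file (OURS) for PROGRAMME-clean-dim2 / T2 (`stub_step ≡ stub_lemma23`), line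
`via-clean-models` of crux `DescentPerfectToAll` (stmt-0549). Nothing here is a statement of
Hironaka's manuscript.

Giraud 1983, 1.3: "`(Spec 𝒪_X/J(X, f))_red = E(f)`", read prime by prime at a STALK: for an affine
open `U ∋ x` with `Ω[Γ(X,U)⁄ℤ]` projective (every affine open of a regular scheme locally of finite
type over a field, res-L1-type-o1's p565123) and `E(f)` closed,

  `J(𝒪_{X,x}, f_x) ≤ P ↔ I(E(f))_x ≤ P`   for every prime `P` of `𝒪_{X,x}`

(`derivJacobianIdeal_stalk_le_prime_iff`, from res-L0-w81-pv-2's chart form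
`derivJacobianIdeal_le_prime_iff_vanishingIdeal_le` by localisation). Consequences, in the shape
«`P ∈ crit ↔ P` prime `∧ ht P = 1 ∧ g ∈ P`» consumed by res-L0-w81-pv-1's adapters
(`…GiraudCriticalPrimesAdapters.lean` p572008):

* `mem_derivCriticalPrimes_stalk_iff_of_radical_eq` — if `I(E(f))_x = √(g)` then
  `crit(𝒪_{X,x}, f_x) = {P prime, ht P = 1, g ∈ P}`; in particular ((d1)-shape, no radical)
  `mem_derivCriticalPrimes_stalk_iff_of_eq_span` when `I(E(f))_x = (g)` (snc point: `g = x` or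
  `g = x·y`);
* `mem_derivCriticalPrimes_stalk_blowup_iff` — **(d2)**: for `π : X₁ → X` with
  `E(π^* f) = π⁻¹ E(f)` (brick B2) and `I(E(f))_ξ = (g)`, at every `ξ₁` over `ξ`:
  `crit(𝒪_{X₁,ξ₁}, (π^* f)_{ξ₁}) = {P prime, ht P = 1, π^♯ g ∈ P}` — since
  `I(π⁻¹E(f))_{ξ₁} = √(I(E(f))_ξ · 𝒪_{X₁,ξ₁})` (`stalkIdeal_vanishingIdeal_preimage`);
* `mem_derivCriticalPrimes_range_stalkEmb_iff` — the same read inside `K(X)` on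
  `T = im ε_{ξ₁}` (the scheme→chart bridge `…T2BlowupStalkChart.lean`), for the blow-up of the
  closed point `ξ`: `crit(T, f) = {P prime, ht P = 1, g ∈ P}` with `f, g` the images in `R ≤ T`.

## References
* J. Giraud, Forme normale d'une fonction sur une surface de caractéristique positive,
  Bull. SMF 111 (1983), Déf. 1.2, 1.3, 2.2. [Giraud1983]
-/

noncomputable section

set_option linter.dupNamespace false -- mandated namespace of this single-conjunct summit

open CategoryTheory AlgebraicGeometry TopologicalSpace IsLocalRing
open Literature.AlgebraicGeometry.Resolution

namespace Summit.ResolutionOfSingularities.ResolutionOfSingularities.Theorems.RadicialJung.CleanModels.T2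

open Scheme.IdealSheafData

/-! ## Giraud 1.3 at a stalk -/

/-- **`J(𝒪_{X,x}, f_x) ≤ P ↔ I(E(f))_x ≤ P`** for every prime `P` of the stalk, `x` in an affine
open `U` with `Ω[Γ(X,U)⁄ℤ]` projective, `E(f)` closed (Giraud's `V(J(X, f)) = E(f)` read at the
generic points of the branches through `x`). [cite: Giraud1983, 1.3] -/
theorem derivJacobianIdeal_stalk_le_prime_iff {X : Scheme.{0}} {U : X.Opens} (hU : IsAffineOpen U)
    [Module.Projective Γ(X, U) Ω[Γ(X, U)⁄ℤ]] (f : Γ(X, ⊤))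
    (hE : IsClosed (derivCriticalSet X f)) {x : X} (hx : x ∈ U)
    (P : Ideal (X.presheaf.stalk x)) [P.IsPrime] :
    derivJacobianIdeal (X.presheaf.stalk x) (X.presheaf.germ ⊤ x trivial f) ≤ P ↔
      stalkIdeal (vanishingIdeal ⟨derivCriticalSet X f, hE⟩) x ≤ P := by
  letI := TopCat.Presheaf.algebra_section_stalk X.presheaf (⟨x, hx⟩ : U)
  haveI := hU.isLocalization_stalk ⟨x, hx⟩
  -- the prime of `Γ(X, U)` under `P`
  let 𝔮 : PrimeSpectrum Γ(X, U) := ⟨P.comap (algebraMap Γ(X, U) (X.presheaf.stalk x)), inferInstance⟩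
  have hgerm : algebraMap Γ(X, U) (X.presheaf.stalk x)
      (X.presheaf.map (homOfLE le_top).op f) = X.presheaf.germ ⊤ x trivial f :=
    X.presheaf.germ_res_apply (homOfLE le_top) _ hx f
  -- both ideals are extended from `Γ(X, U)`
  have hJ : derivJacobianIdeal (X.presheaf.stalk x) (X.presheaf.germ ⊤ x trivial f) =
      (derivJacobianIdeal Γ(X, U) (X.presheaf.map (homOfLE le_top).op f)).map
        (algebraMap Γ(X, U) (X.presheaf.stalk x)) := by
    rw [← hgerm]
    exact derivJacobianIdeal_eq_map_of_isLocalization (X.presheaf.stalk x)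
      (hU.primeIdealOf ⟨x, hx⟩).asIdeal.primeCompl (X.presheaf.map (homOfLE le_top).op f)
  have hI : stalkIdeal (vanishingIdeal ⟨derivCriticalSet X f, hE⟩) x =
      ((vanishingIdeal ⟨derivCriticalSet X f, hE⟩).ideal ⟨U, hU⟩).map
        (algebraMap Γ(X, U) (X.presheaf.stalk x)) :=
    stalkIdeal_eq_map_germ _ ⟨U, hU⟩ hx
  rw [hJ, hI, Ideal.map_le_iff_le_comap, Ideal.map_le_iff_le_comap]
  exact derivJacobianIdeal_le_prime_iff_vanishingIdeal_le hU f hE 𝔮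

/-- **The critical primes at a stalk from a radical generator**: if `I(E(f))_x = √(g)` then the
critical primes of `f_x` are exactly the height-one primes containing `g`.
[cite: Giraud1983, 1.3 and Déf. 1.2 (1)] -/
theorem mem_derivCriticalPrimes_stalk_iff_of_radical_eq {X : Scheme.{0}} {U : X.Opens}
    (hU : IsAffineOpen U) [Module.Projective Γ(X, U) Ω[Γ(X, U)⁄ℤ]] (f : Γ(X, ⊤))
    (hE : IsClosed (derivCriticalSet X f)) {x : X} (hx : x ∈ U) {g : X.presheaf.stalk x}
    (hg : stalkIdeal (vanishingIdeal ⟨derivCriticalSet X f, hE⟩) x = (Ideal.span {g}).radical)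
    (P : Ideal (X.presheaf.stalk x)) :
    P ∈ derivCriticalPrimes (X.presheaf.stalk x) (X.presheaf.germ ⊤ x trivial f) ↔
      P.IsPrime ∧ P.height = 1 ∧ g ∈ P := by
  constructor
  · rintro ⟨hP, hh, hJ⟩
    haveI := hP
    refine ⟨hP, hh, ?_⟩
    have h := (derivJacobianIdeal_stalk_le_prime_iff hU f hE hx P).mp hJ
    rw [hg, hP.radical_le_iff, Ideal.span_singleton_le_iff_mem] at h
    exact h
  · rintro ⟨hP, hh, hgP⟩
    haveI := hP
    refine ⟨hP, hh, ?_⟩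
    rw [derivJacobianIdeal_stalk_le_prime_iff hU f hE hx P, hg, hP.radical_le_iff,
      Ideal.span_singleton_le_iff_mem]
    exact hgP

/-- **(d1)-shape**: if `I(E(f))_x = (g)` (a strict normal crossings point: `g = x` or `g = x·y`
for regular parameters) then the critical primes of `f_x` are the height-one primes containing
`g`. [cite: Giraud1983, 1.3 and Déf. 1.2 (1)] -/
theorem mem_derivCriticalPrimes_stalk_iff_of_eq_span {X : Scheme.{0}} {U : X.Opens}
    (hU : IsAffineOpen U) [Module.Projective Γ(X, U) Ω[Γ(X, U)⁄ℤ]] (f : Γ(X, ⊤))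
    (hE : IsClosed (derivCriticalSet X f)) {x : X} (hx : x ∈ U) {g : X.presheaf.stalk x}
    (hg : stalkIdeal (vanishingIdeal ⟨derivCriticalSet X f, hE⟩) x = Ideal.span {g})
    (P : Ideal (X.presheaf.stalk x)) :
    P ∈ derivCriticalPrimes (X.presheaf.stalk x) (X.presheaf.germ ⊤ x trivial f) ↔
      P.IsPrime ∧ P.height = 1 ∧ g ∈ P := by
  constructor
  · rintro ⟨hP, hh, hJ⟩
    haveI := hP
    refine ⟨hP, hh, ?_⟩
    have h := (derivJacobianIdeal_stalk_le_prime_iff hU f hE hx P).mp hJ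
    rw [hg, Ideal.span_singleton_le_iff_mem] at h
    exact h
  · rintro ⟨hP, hh, hgP⟩
    haveI := hP
    refine ⟨hP, hh, ?_⟩
    rw [derivJacobianIdeal_stalk_le_prime_iff hU f hE hx P, hg, Ideal.span_singleton_le_iff_mem]
    exact hgP

/-! ## (d2): the critical primes at the points of a blow-up over the centre -/

/-- **(d2) The critical primes of `π^* f` at a point `ξ₁` over `ξ`.** Let `π : X₁ → X` satisfy
`E(π^* f) = π⁻¹ E(f)` (brick B2; e.g. the blow-up of a closed point of `E(f)`), `E(f)` closed,
`I(E(f))_{π ξ₁} = (g)`, and let `ξ₁` lie in an affine open `U₁` of `X₁` with `Ω[Γ(X₁,U₁)⁄ℤ]`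
projective. Then the critical primes of `(π^* f)_{ξ₁}` are exactly the height-one primes of
`𝒪_{X₁,ξ₁}` containing `π^♯ g` (because `I(π⁻¹E(f))_{ξ₁} = √(g · 𝒪_{X₁,ξ₁})`).
[cite: Giraud1983, 1.3 and 2.5] -/
theorem mem_derivCriticalPrimes_stalk_blowup_iff {X₁ X : Scheme.{0}} (π : X₁ ⟶ X) (f : Γ(X, ⊤))
    (hE : IsClosed (derivCriticalSet X f))
    (hE₁ : derivCriticalSet X₁ (π.appTop f) = π ⁻¹' derivCriticalSet X f)
    {U₁ : X₁.Opens} (hU₁ : IsAffineOpen U₁) [Module.Projective Γ(X₁, U₁) Ω[Γ(X₁, U₁)⁄ℤ]]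
    (ξ₁ : X₁) (hξ₁ : ξ₁ ∈ U₁) {g : X.presheaf.stalk (π ξ₁)}
    (hg : stalkIdeal (vanishingIdeal ⟨derivCriticalSet X f, hE⟩) (π ξ₁) = Ideal.span {g})
    (P : Ideal (X₁.presheaf.stalk ξ₁)) :
    P ∈ derivCriticalPrimes (X₁.presheaf.stalk ξ₁) (X₁.presheaf.germ ⊤ ξ₁ trivial (π.appTop f)) ↔
      P.IsPrime ∧ P.height = 1 ∧ (π.stalkMap ξ₁).hom g ∈ P := by
  have hE₁cl : IsClosed (derivCriticalSet X₁ (π.appTop f)) := by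
    rw [hE₁]; exact hE.preimage π.continuous
  refine mem_derivCriticalPrimes_stalk_iff_of_radical_eq hU₁ (π.appTop f) hE₁cl hξ₁ ?_ P
  -- `I(π⁻¹ E)_{ξ₁} = √(I(E)_{π ξ₁} · 𝒪_{X₁,ξ₁}) = √(g)`
  have hcl : (⟨derivCriticalSet X₁ (π.appTop f), hE₁cl⟩ : Closeds X₁) =
      (⟨derivCriticalSet X f, hE⟩ : Closeds X).preimage π.continuous := by
    apply Closeds.ext
    simp only [Closeds.coe_mk, Closeds.coe_preimage]
    exact hE₁
  rw [hcl, stalkIdeal_vanishingIdeal_preimage, hg, Ideal.map_span, Set.image_singleton]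

/-! ## The same on `T = im ε_{ξ₁} ≤ K(X)` -/

/-- **(d2) inside `K(X)`.** For the blow-up `π` of the closed point `ξ` of an integral `X`
(`IsBlowup π 𝓘_{ξ}`), `ξ₁` over `ξ`, `R = im(𝒪_{X,ξ})`, `T = im ε_{ξ₁}` (the scheme→chart bridge of
`…T2BlowupStalkChart.lean`): under the hypotheses of `mem_derivCriticalPrimes_stalk_blowup_iff`,
the critical primes of the image of `f` in `T` are the height-one primes of `T` containing the
image of `g`. [cite: Giraud1983, 1.3 and 2.5] -/
theorem mem_derivCriticalPrimes_range_stalkEmb_iff {X₁ X : Scheme.{0}} [IsIntegral X]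
    [IsLocallyNoetherian X] {π : X₁ ⟶ X} {ξ : X} (hξ : IsClosed ({ξ} : Set X))
    (hπ : IsBlowup π (vanishingIdeal ⟨{ξ}, hξ⟩)) (f : Γ(X, ⊤))
    (hE : IsClosed (derivCriticalSet X f))
    (hE₁ : derivCriticalSet X₁ (π.appTop f) = π ⁻¹' derivCriticalSet X f)
    {U₁ : X₁.Opens} (hU₁ : IsAffineOpen U₁) [Module.Projective Γ(X₁, U₁) Ω[Γ(X₁, U₁)⁄ℤ]]
    (ξ₁ : X₁) (hξ₁ : ξ₁ ∈ U₁) {g : X.presheaf.stalk (π ξ₁)}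
    (hg : stalkIdeal (vanishingIdeal ⟨derivCriticalSet X f, hE⟩) (π ξ₁) = Ideal.span {g})
    (P : Ideal (hπ.stalkEmb ξ₁).range) :
    P ∈ derivCriticalPrimes (hπ.stalkEmb ξ₁).range
        ⟨algebraMap (X.presheaf.stalk (π ξ₁)) X.functionField (X.presheaf.germ ⊤ (π ξ₁) trivial f),
          range_algebraMap_le_range_stalkEmb hπ ξ₁ ⟨_, rfl⟩⟩ ↔
      P.IsPrime ∧ P.height = 1 ∧
        (⟨algebraMap (X.presheaf.stalk (π ξ₁)) X.functionField g,
          range_algebraMap_le_range_stalkEmb hπ ξ₁ ⟨_, rfl⟩⟩ : (hπ.stalkEmb ξ₁).range) ∈ P := by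
  obtain ⟨e, he⟩ := exists_ringEquiv_range_stalkEmb hπ ξ₁
  -- the images of `f_{ξ₁}` and `π^♯ g` under `e`
  have hef : e (X₁.presheaf.germ ⊤ ξ₁ trivial (π.appTop f)) =
      ⟨algebraMap (X.presheaf.stalk (π ξ₁)) X.functionField (X.presheaf.germ ⊤ (π ξ₁) trivial f),
        range_algebraMap_le_range_stalkEmb hπ ξ₁ ⟨_, rfl⟩⟩ := by
    apply Subtype.ext
    rw [he]
    change hπ.stalkEmb ξ₁ _ =
      algebraMap (X.presheaf.stalk (π ξ₁)) X.functionField (X.presheaf.germ ⊤ (π ξ₁) trivial f)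
    rw [← hπ.stalkEmb_stalkMap ξ₁, Scheme.Hom.germ_stalkMap_apply]
    rfl
  have heg : e ((π.stalkMap ξ₁).hom g) =
      ⟨algebraMap (X.presheaf.stalk (π ξ₁)) X.functionField g,
        range_algebraMap_le_range_stalkEmb hπ ξ₁ ⟨_, rfl⟩⟩ := by
    apply Subtype.ext
    rw [he, hπ.stalkEmb_stalkMap ξ₁]
  rw [← hef, derivCriticalPrimes_ringEquiv e]
  constructor
  · rintro ⟨P₀, hP₀, rfl⟩
    obtain ⟨hP, hh, hgP⟩ :=
      (mem_derivCriticalPrimes_stalk_blowup_iff π f hE hE₁ hU₁ ξ₁ hξ₁ hg P₀).mp hP₀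
    haveI := hP
    refine ⟨Ideal.map_isPrime_of_equiv _, by rw [RingEquiv.height_map]; exact hh, ?_⟩
    rw [← heg]
    exact Ideal.mem_map_of_mem _ hgP
  · rintro ⟨hP, hh, hgP⟩
    haveI := hP
    refine ⟨P.map (e.symm : _ →+* X₁.presheaf.stalk ξ₁), ?_, ?_⟩
    · refine (mem_derivCriticalPrimes_stalk_blowup_iff π f hE hE₁ hU₁ ξ₁ hξ₁ hg _).mpr
        ⟨Ideal.map_isPrime_of_equiv _, ?_, ?_⟩
      · rw [Ideal.map_coe, RingEquiv.height_map]; exact hh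
      · rw [Ideal.map_coe]
        have : e.symm (e ((π.stalkMap ξ₁).hom g)) ∈ P.map e.symm :=
          Ideal.mem_map_of_mem _ (by rw [heg]; exact hgP)
        rwa [e.symm_apply_apply] at this
    · have := Ideal.map_of_equiv (I := P) e.symm
      rwa [RingEquiv.symm_symm] at this

end Summit.ResolutionOfSingularities.ResolutionOfSingularities.Theorems.RadicialJung.CleanModels.T2

end
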